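import Summits.QuantumFields.YangMills.Theorems.BalabanUVNodesN06AtRecord11CB10YZW
import Literature.MathematicalPhysics.QuantumFieldTheory.Balaban1983to89.B8LeafKnitZd3B9All

/-!
# BalabanUVNodes ∕ N05 ([B8], `Dag.B8_main`) AT NODE 00's FIVE-PIN STAGE-11 CARRIER RECORD `Node00.IsRecordOfRecord₁₁CB10YZWB8` — READINGS · CLOSERS BY NAME in
# both currencies (the ∀-form stub `S_N05` and the pointed ∃-currency of K1 `StabilityBAtRecordR11e`) · THE KNIT AT ₁₁ (node00-def g31's `b8LeafOfRecord_of_knit` and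
# its four-socket twin over dag-n05-a's `B8LeafKnitZd3B9All`) · GUARDS (the ∀-form over the five-pin record is REFUTED under inhabitation; what N05 costs in K1's currency)

Track A of `YM-PLAN.md` (cell `pub-ymgap`, HUMAN RULING D-0062), node **N05** = [Balaban1985RegularSpaces] Lemma 1, Thm 2, Prop 3, Thm 4, Props 5–7, Thm 8; R134
fan-out seat `pub-ymgap-dag-n05-d` (strategy s2 = BY-NAME KNIT ∕ REDUCTION at the ₁₁ record; dag-lead REBALANCE №51 (i), FAN-OUT v1.1 §N05 s2 (iv)).  The route
`BalabanUVNodes` was RESTATED at def-T's Stage-11 record (rev 6, T-day 2026-08-26): K1 `StabilityBAtRecordR11e` quantifies over `Node00.IsRecordOfRecord₁₁C F 2` in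
∃-form («the prover chooses the record»); node00-def g31's `Node00/Record11CarriersB8.lean` (p446171) is the record with ALL FIVE typed carrier groups pinned, the [B8]
group = dag-n05-a's `zdGF3` family of record over print's admitted index `IdxB8 θ` (`Ω₀ = T_η`), `b8` in its SURVIVING form `B8LeafOfRecord θ₃ λ` (`B8LeafKnitRS.B8LeafRS`),
the residual [B8] layer `λ : ResidB8 θ₃` (Hölder data, Prop-5 ∕ Prop-6 carriers, axial map, [4] inputs, constants) ∃-quantified WITH NO LAW.  This module says what N05
IS there, BY NAME — nothing of [B8] is restated; the knits `Node00.b8LeafOfRecord_of_knit` (g31) ∕ `B8LeafKnitZd3B9All.b8LeafRS_zd3_univ_b9all` (n05-a g6), g31's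
located junk certificate `exists_residB8_not_b8LeafOfRecord` and def-Y's `exists_junkOps_b9LeafX_Y9OfRecord` are IMPORTED.  Kernel bookkeeping: 0 `def`, 0 `sorry`,
standard axioms.  COUNT-NEUTRAL; `--supports` item K1 `StabilityBAtRecordR11e` (stmt-QuantumFields-19674).

THE REFINEMENT OF RECORD for the in-edges `b4 b5 b6 b7` is g31's `b4_b5_b6_b7_of_isRecordOfRecord₁₁CB10YZWB8` (same-datum companion in ₁₁CB10YZW, then ₁₁C → ₅C at
the shadow), so at a five-pin record N05 IS «`b9 → b8`», which g31's faces read as «`B9LeafX (Y9OfRecord N θ₃ M⋆ ops) → B8LeafOfRecord θ₃ λ`» at the presenting package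
— the in-edge b9 = def-Y's extended leaf at the [B9] bundle of record (operator layer `ops` residual), the leaf = the surviving [B8] leaf at the group of record.

WHAT THIS MODULE PROVES.
* §1 READINGS: `s_N05_iff₁₁CB10YZWB8` (`Iff.rfl`) · `b8_main_iff_edge_of_…` (N05 IS «`b9 → b8`») · `b8_main_iff_bundles_of_…` (the face through the pinned bundles)
  · `s_N05_iff_edge₁₁CB10YZWB8`.
* §2 CLOSERS BY NAME, ∀-currency: `b8_main_of_isRecordOfRecord₁₁CB10YZWB8_of_edgeSlot` (per record, slot = «b9-leaf → b8-leaf» at every presenting package; g31's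
  `…_of_slots` is the b9-free special case) · `s_N05_record₁₁CB10YZWB8_of_edgeSlot` · `s_N05_of_refines₁₁CB10YZWB8`.
  ∃-currency (K1 V1: the prover CHOOSES the record, in particular `λ`): `b8_main_of_up_view₁₁B8B10YZW` (at ANY world bound over g31's five-pin Stage-11 view of a
  package, «b9-leaf → `B8LeafOfRecord θ₃ λ`» gives `Dag.B8_main` at every run) and THE KNIT AT ₁₁ — **`b8_main_of_up_view₁₁B8B10YZW_of_knit`**: `Dag.B8_main` at every run of
  such a world FROM EXACTLY the hypotheses of `Node00.b8LeafOfRecord_of_knit` (`θ.D ≥ 2`, `λ.B₁′ = 5dL·B₀`, `2 ≤ 5dL·B₀`, `B₀(β₀) > 0`, `C₂ ≥ 2097152(d+1)²`, the five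
  member-wise SOCKETS `SockHFP₀ ∕ SockHFP ∕ SockH59 ∕ SockP5u ∕ SockB9P3` of Theorem 4 ∕ Proposition 3 over `ZdIdx θ.D θ.L`, the five printed members `p5e p5u p6 p7 t8S`),
  and its FOUR-SOCKET twin **`b8_main_of_up_view₁₁B8B10YZW_of_knit_b9all`** over n05-a g6's `b8LeafRS_zd3_univ_b9all` (b9 as ONE all-levels socket `SB9all`, `SockH59`
  served from it) — via `b8LeafOfRecord_of_knit_b9all`, the four-socket face of `B8LeafOfRecord`.
* §3 GUARDS — THE HONESTY OF THE MODULE: `exists_record₁₁CB10YZWB8_leaves_iff` (every package presents a record, pins exposed) · `s_N05_iff₁₁CB10YZWB8_bundles`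
  (`S_N05 (₁₁CB10YZWB8)` ⟺ «for every family, every admissible `θ : Stage11Params` with provisos and `γ > 0`, EVERY `λ`, floor, operator layer: b9-leaf → `B8LeafOfRecord θ₃ λ`»)
  · **`not_s_N05_record₁₁CB10YZWB8`** (ONE admissible Stage-11 parameter with provisos and `γ > 0` REFUTES the ∀-form: def-Y's junk operator layer makes the b9 leaf TRUE
  while g31's junk residual layer makes the b8 leaf FALSE — the ∀-form over the five-pin record is NOT an N05 target; under K0 it is FALSE) · `inhabited₁₁CB10YZWB8_iff_inhabited₁₁C`
  (the five pins add no proviso) · `exists_rebind₁₁CB10YZWB8_of_isRecordOfRecord₁₁C` (K1-currency, LOCATED: every ₁₁C record's datum is presented, for EVERY residual layer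
  `λ` of the prover's choice, by a five-pin world at which `Dag.B8_main ⟺ B8LeafOfRecord θ₃ λ` at every run — so what N05 costs in K1's ∃-form is EXACTLY the knit's
  hypothesis list at the record's `(θ.𝔸, θ.D, θ.L)` for a `λ` the prover names: the sockets + the five printed members; today three sockets have providers in flight
  (`SockHFP₀∕SockHFP`: `B8SockHFPAssembly` + windows + [4] letters; `SockP5u`: n04-b №14; `SB9all`: N06's supply `sB9all_of_thm33`) and `p5e p5u p6 p7 t8S` are open).

HONEST FRAMING.  [B8]'s theorems are NOT proved here for Bałaban's objects beyond what the imported knits prove (Lemma 1, Thm 2, Prop 3, Thm 4 at the prototype MODULO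
the sockets); every closer takes the sockets ∕ printed members ∕ the edge slot AS HYPOTHESES; N05 is NOT discharged (typed 28∕28, discharged 5∕27 untouched by this file);
one finite four-torus programme at fixed `ε` — NOT ℝ⁴, NOT infinite volume, NOT OS, NOT a mass gap, NOT Clay.  Restate-immune (no `def`).
-/

noncomputable section

namespace Summit.QuantumFields.YangMills.BalabanUVNodes.N05AtRecord11CB10YZWB8

open Literature.MathematicalPhysics.QuantumFieldTheory.Balaban1983to89
open Literature.MathematicalPhysics.QuantumFieldTheory.Balaban1983to89.T4Continuum (T4Family FiniteEpsData)
open Literature.MathematicalPhysics.QuantumFieldTheory.Balaban1983to89.DagBinding (WorldP leavesP B9LeafX)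
open Literature.MathematicalPhysics.QuantumFieldTheory.Balaban1983to89.Node00
open Literature.MathematicalPhysics.QuantumFieldTheory.Balaban1983to89.B9PinMembersKLevelV1 (MemberY geo9Y bg9Y)
open Literature.MathematicalPhysics.QuantumFieldTheory.Balaban1983to89.B7Prop2SpecialUnitary (specialUnitaryUnits)
open Literature.MathematicalPhysics.QuantumFieldTheory.Balaban1983to89.B8LeafModelZd (ZdIdx SockH59 SockP5u)
open Literature.MathematicalPhysics.QuantumFieldTheory.Balaban1983to89.B8LeafModelZdOfHFP (SockHFP₀ SockHFP)
open Literature.MathematicalPhysics.QuantumFieldTheory.Balaban1983to89.B8LeafModelZd3 (SockB9P3)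
open YMDAG.UVSplit (RecordPred Datum AtRecord S_N05)
open Summit.QuantumFields.YangMills.BalabanUVNodes.N06AtRecord9CB10Y (exists_junkOps_b9LeafX_Y9OfRecord)
open Summit.QuantumFields.YangMills.BalabanUVNodes.N06AtRecord11CB10YZW (inhabited₁₁CB10YZW_iff_inhabited₁₁C)
open scoped Matrix.Norms.L2Operator

variable {N : ℕ} [NeZero N]

/-! ## §1 readings at the five-pin Stage-11 carrier record -/

/-- **What `S_N05` says over the five-pin Stage-11 carrier record** (`Iff.rfl`): at every ₁₁CB10YZWB8 record and every run, `Dag.B8_main`.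
[cite: Balaban1985RegularSpaces, Lemma 1 – Thm 8 pp.79–101 (the node's shape `Dag.B8_main`, bookkeeping)] -/
theorem s_N05_iff₁₁CB10YZWB8 :
    S_N05 (fun F D w => IsRecordOfRecord₁₁CB10YZWB8 F N D w) ↔
      ∀ (F : T4Family) (D : Datum F N) (w : WorldP), IsRecordOfRecord₁₁CB10YZWB8 F N D w → ∀ P : B12.RunParams, Dag.B8_main (leavesP w P) :=
  Iff.rfl

section Record

variable {F : T4Family} {D : FiniteEpsData F (Node00.SU N)} {w : WorldP}

/-- **At a ₁₁CB10YZWB8 record N05 IS THE EDGE «`b9 → b8`»** (the in-edges `b5 b6 b7` HOLD by g31's `b4_b5_b6_b7_of_isRecordOfRecord₁₁CB10YZWB8` — N02 ∕ N03 ∕ N04 at the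
Stage-5 shadow through the same-datum companion; the first conjunct of g31's `b8_b11_b10_main_iff_of_…`, pointed). [cite: Balaban1985RegularSpaces, Thm 2 p.83, Thm 8 p.101 (bookkeeping)] -/
theorem b8_main_iff_edge_of_isRecordOfRecord₁₁CB10YZWB8 (h : IsRecordOfRecord₁₁CB10YZWB8 F N D w) (P : B12.RunParams) :
    Dag.B8_main (leavesP w P) ↔ ((leavesP w P).b9 → (leavesP w P).b8) :=
  (b8_b11_b10_main_iff_of_isRecordOfRecord₁₁CB10YZWB8 h P).1

/-- **At a ₁₁CB10YZWB8 record N05 IS «def-Y's extended [B9] leaf → the surviving [B8] leaf» AT THE BUNDLES OF RECORD** of the presenting package `(θ, λ, M⋆, ops)`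
(g31's `nodes_iff_bundles_of_isRecordOfRecord₁₁CB10YZWB8`, first conjunct). [cite: Balaban1985RegularSpaces, Lemma 1 – Thm 8 pp.79–101; Balaban1985BackgroundPropagators, Thm 3.1 p.397 (the pinned in-edge object; bookkeeping)] -/
theorem b8_main_iff_bundles_of_isRecordOfRecord₁₁CB10YZWB8 (h : IsRecordOfRecord₁₁CB10YZWB8 F N D w) :
    ∃ (θ : Stage11Params F N) (lam : ResidB8 θ.toStage3Params) (Mstar : ℕ) (ops : OpsY N θ.toStage3Params Mstar), θ.Admissible ∧ w.L = (θ.L : ℝ) ∧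
      ∀ P : B12.RunParams,
        Dag.B8_main (leavesP w P) ↔ (B9LeafX (Y9OfRecord N θ.toStage3Params Mstar ops) → B8LeafOfRecord θ.toStage3Params lam) := by
  obtain ⟨θ, lam, Mstar, ops, ζ, hθ, hL, hl⟩ := nodes_iff_bundles_of_isRecordOfRecord₁₁CB10YZWB8 h
  exact ⟨θ, lam, Mstar, ops, hθ, hL, fun P => (hl P).1⟩

end Record

/-- **`S_N05` over ₁₁CB10YZWB8 IS «`b9 → b8` at every run of every record»**. [cite: Balaban1985RegularSpaces, Lemma 1 – Thm 8 pp.79–101 (bookkeeping)] -/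
theorem s_N05_iff_edge₁₁CB10YZWB8 :
    S_N05 (fun F D w => IsRecordOfRecord₁₁CB10YZWB8 F N D w) ↔
      ∀ (F : T4Family) (D : Datum F N) (w : WorldP), IsRecordOfRecord₁₁CB10YZWB8 F N D w →
        ∀ P : B12.RunParams, (leavesP w P).b9 → (leavesP w P).b8 :=
  ⟨fun h F D w hR P => (b8_main_iff_edge_of_isRecordOfRecord₁₁CB10YZWB8 hR P).1 (h F D w hR P),
    fun h F D w hR P => (b8_main_iff_edge_of_isRecordOfRecord₁₁CB10YZWB8 hR P).2 (h F D w hR P)⟩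

/-! ## §2 closers BY NAME — ∀-currency (the stub `S_N05`) -/

/-- **N05 AT ONE ₁₁CB10YZWB8 RECORD FROM ITS EDGE SLOT, PACKAGE FORM**: if for every package `(θ, h, λ, M⋆, ops, ζ, λ_W)` PRESENTING the record def-Y's extended [B9] leaf at
the bundle of record implies the surviving [B8] leaf at the group of record, then `Dag.B8_main` at every run (g31's `b8_main_of_isRecordOfRecord₁₁CB10YZWB8_of_slots` is the
b9-free special case).  The slot quantifies over the HIDDEN residual layer `λ` — honest, and §3 says what that costs. [cite: Balaban1985RegularSpaces, Lemma 1 – Thm 8 pp.79–101 (bookkeeping)] -/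
theorem b8_main_of_isRecordOfRecord₁₁CB10YZWB8_of_edgeSlot {F : T4Family} {D : Datum F N} {w : WorldP} (h : IsRecordOfRecord₁₁CB10YZWB8 F N D w)
    (hB : ∀ (θ : Stage11Params F N) (hP : θ.Provisos₁₁) (lam : ResidB8 θ.toStage3Params) (Mstar : ℕ) (ops : OpsY N θ.toStage3Params Mstar) (ζ : ResidZ F N)
      (lamW : ResidW F N), θ.Admissible → D = datumOfRecord₁₁ F N θ hP →
        (∀ P, w.up P = upOfRecord₅CS F N (θ.view₁₁B8B10YZW F N lam Mstar ops ζ lamW) P) →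
          B9LeafX (Y9OfRecord N θ.toStage3Params Mstar ops) → B8LeafOfRecord θ.toStage3Params lam)
    (P : B12.RunParams) : Dag.B8_main (leavesP w P) := by
  obtain ⟨θ, hP, lam, Mstar, ops, ζ, lamW, hθ, hD, -, -, -, hup⟩ := h
  intro _ _ _ h9
  have h9' : (w.up P).b9 := h9
  rw [hup P] at h9'
  show (w.up P).b8
  rw [hup P]
  exact (upOfRecord₅CS_view₁₁B8B10YZW_leaves F N θ lam Mstar ops ζ lamW P).1.2
    (hB θ hP lam Mstar ops ζ lamW hθ hD hup ((upOfRecord₅CS_view₁₁B8B10YZW_leaves F N θ lam Mstar ops ζ lamW P).2.2.1.1 h9'))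

/-- **`S_N05 (₁₁CB10YZWB8)` FROM THE EDGE SLOT, PACKAGE FORM** (`b8_main_of_isRecordOfRecord₁₁CB10YZWB8_of_edgeSlot` at every record).
[cite: Balaban1985RegularSpaces, Lemma 1 – Thm 8 pp.79–101 (bookkeeping)] -/
theorem s_N05_record₁₁CB10YZWB8_of_edgeSlot
    (hslot : ∀ (F : T4Family) (D : Datum F N) (w : WorldP), IsRecordOfRecord₁₁CB10YZWB8 F N D w →
      ∀ (θ : Stage11Params F N) (hP : θ.Provisos₁₁) (lam : ResidB8 θ.toStage3Params) (Mstar : ℕ) (ops : OpsY N θ.toStage3Params Mstar) (ζ : ResidZ F N)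
        (lamW : ResidW F N), θ.Admissible → D = datumOfRecord₁₁ F N θ hP →
          (∀ P, w.up P = upOfRecord₅CS F N (θ.view₁₁B8B10YZW F N lam Mstar ops ζ lamW) P) →
            B9LeafX (Y9OfRecord N θ.toStage3Params Mstar ops) → B8LeafOfRecord θ.toStage3Params lam) :
    S_N05 (fun F D w => IsRecordOfRecord₁₁CB10YZWB8 F N D w) :=
  fun F D w h P => b8_main_of_isRecordOfRecord₁₁CB10YZWB8_of_edgeSlot h (hslot F D w h) P

/-- **`S_N05 Rec` FOR EVERY RECORD PREDICATE REFINING ₁₁CB10YZWB8**, from the BUNDLE slot «b9-leaf → b8-leaf for every Stage-3 dictionary with admissible Stage-1 part,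
EVERY residual [B8] layer, floor and operator layer» (refinement-generic: the next carrier pins re-key by this line; the slot is what a proof of the ∀-form must supply,
and §3 `not_s_N05_record₁₁CB10YZWB8` says it is unsatisfiable as typed — the honest ∀-closer is vacuous until `λ` carries law). [cite: Balaban1985RegularSpaces, Lemma 1 – Thm 8 pp.79–101 (bookkeeping)] -/
theorem s_N05_of_refines₁₁CB10YZWB8 (Rec : RecordPred N)
    (href : ∀ (F : T4Family) (D : Datum F N) (w : WorldP), Rec F D w → IsRecordOfRecord₁₁CB10YZWB8 F N D w)
    (hslot : ∀ (θ₃ : Stage3Params), θ₃.toStage1Params.Admissible → ∀ (lam : ResidB8 θ₃) (Mstar : ℕ) (ops : OpsY N θ₃ Mstar),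
      B9LeafX (Y9OfRecord N θ₃ Mstar ops) → B8LeafOfRecord θ₃ lam) :
    S_N05 Rec := by
  intro F D w hR P
  obtain ⟨θ, lam, Mstar, ops, hθ, -, hiff⟩ := b8_main_iff_bundles_of_isRecordOfRecord₁₁CB10YZWB8 (href F D w hR)
  exact (hiff P).2 (hslot θ.toStage3Params hθ.1.1.1.1.1 lam Mstar ops)

/-! ## §2′ closers BY NAME — ∃-currency (K1 `StabilityBAtRecordR11e`, V1 ∃-form: the prover chooses the package, `λ` included) and THE KNIT AT ₁₁ -/

section Pointed

variable {F : T4Family}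

/-- **N05 AT ANY WORLD BOUND OVER THE FIVE-PIN STAGE-11 VIEW, FROM THE EDGE AT THE CHOSEN PACKAGE**: if `w.up P = upOfRecord₅CS (θ.view₁₁B8B10YZW λ M⋆ ops ζ λ_W) P`
at every run, then «`B9LeafX (Y9OfRecord N θ₃ M⋆ ops) → B8LeafOfRecord θ₃ λ`» gives `Dag.B8_main (leavesP w P)` at every run (g31's `upOfRecord₅CS_view₁₁B8B10YZW_leaves`;
the in-edges `b5 b6 b7` are not even needed).  This is the shape K1's prover consumes at the record it CHOOSES. [cite: Balaban1985RegularSpaces, Lemma 1 – Thm 8 pp.79–101 (bookkeeping)] -/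
theorem b8_main_of_up_view₁₁B8B10YZW (θ : Stage11Params F N) (lam : ResidB8 θ.toStage3Params) (Mstar : ℕ) (ops : OpsY N θ.toStage3Params Mstar)
    (ζ : ResidZ F N) (lamW : ResidW F N) (w : WorldP) (hup : ∀ P, w.up P = upOfRecord₅CS F N (θ.view₁₁B8B10YZW F N lam Mstar ops ζ lamW) P)
    (hedge : B9LeafX (Y9OfRecord N θ.toStage3Params Mstar ops) → B8LeafOfRecord θ.toStage3Params lam) (P : B12.RunParams) :
    Dag.B8_main (leavesP w P) := by
  intro _ _ _ h9
  have h9' : (w.up P).b9 := h9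
  rw [hup P] at h9'
  show (w.up P).b8
  rw [hup P]
  exact (upOfRecord₅CS_view₁₁B8B10YZW_leaves F N θ lam Mstar ops ζ lamW P).1.2
    (hedge ((upOfRecord₅CS_view₁₁B8B10YZW_leaves F N θ lam Mstar ops ζ lamW P).2.2.1.1 h9'))

/-- **THE KNIT AT ₁₁ — N05 AT A WORLD BOUND OVER THE FIVE-PIN STAGE-11 VIEW FROM EXACTLY THE HYPOTHESES OF g31's `Node00.b8LeafOfRecord_of_knit`** (n05-a's
`B8LeafKnitZd3.b8LeafRS_zd3_univ` at the group of record, BY NAME): for the chosen Stage-11 parameter `θ` with `θ.D ≥ 2`, a residual [B8] layer `λ` whose Theorem-4 constant is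
print's `B₁′ = 5dL·B₀` with `2 ≤ 5dL·B₀`, `B₀(β₀) > 0`, `C₂ ≥ 2097152(d+1)²`, the member-wise SOCKETS of Theorem 4 ∕ Proposition 3 over `ZdIdx θ.D θ.L` (`SockHFP₀`, `SockHFP`:
Proposition 5's fixed point in plain currency; `SockH59`: (1.59); `SockP5u`: (1.109); `SockB9P3`: [4] Thm 3.3 in Prop. 3's frame) below their thresholds, and the five printed
statements NOT YET instantiated at objects (`p5e`, `p5u`, `p6`, `p7`, `t8` surviving) AS HYPOTHESES — `Dag.B8_main` at every run of any world bound over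
`θ.view₁₁B8B10YZW λ M⋆ ops ζ λ_W` (the b9 edge is not used: the leaf itself holds).  NOT a discharge of N05. [cite: Balaban1985RegularSpaces, Lemma 1 p.79, Thm 2 p.83, Prop. 3 p.87, Thm 4 p.88 (kernel instances, n05-a); Prop. 5 p.94, Prop. 6 p.99, Prop. 7 p.100, Thm 8 p.101 (named hypotheses)] -/
theorem b8_main_of_up_view₁₁B8B10YZW_of_knit (θ : Stage11Params F N) (hD : 2 ≤ θ.D) (lam : ResidB8 θ.toStage3Params) (Mstar : ℕ)
    (ops : OpsY N θ.toStage3Params Mstar) (ζ : ResidZ F N) (lamW : ResidW F N) (w : WorldP)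
    (hup : ∀ P, w.up P = upOfRecord₅CS F N (θ.view₁₁B8B10YZW F N lam Mstar ops ζ lamW) P)
    (hB₁' : lam.B₁' = 5 * (θ.D : ℝ) * θ.L * lam.inp.B₀) {cu cF₀ cF c59 cu' cB9 : ℝ} (hB : 2 ≤ 5 * (θ.D : ℝ) * θ.L * lam.inp.B₀) (hB₀β : 0 < lam.B₀β)
    (hC₂ : 2097152 * ((θ.D : ℝ) + 1) ^ 2 ≤ lam.C₂) (hcu : 0 < cu) (hcF₀ : 0 < cF₀) (hcF : 0 < cF) (hc59 : 0 < c59) (hcu' : 0 < cu') (hcB9 : 0 < cB9)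
    (SHFP₀ : ∀ i : ZdIdx θ.D θ.L, SockHFP₀ (𝔸 := θ.𝔸) θ.L lam.inp.B₀ lam.inp.B₀' cF₀ i.η i.k i.Ω i.Λs)
    (SHFP : ∀ i : ZdIdx θ.D θ.L, SockHFP (𝔸 := θ.𝔸) θ.L lam.inp.B₀ lam.inp.B₀' cF i.η i.k i.Ω i.Λs)
    (SH59 : ∀ i : ZdIdx θ.D θ.L, SockH59 (𝔸 := θ.𝔸) θ.L lam.inp.B₀ lam.inp.B₀' c59 i.η i.k i.Ω i.Λs i.Λb)
    (SP5u : ∀ i : ZdIdx θ.D θ.L, SockP5u (𝔸 := θ.𝔸) θ.L cu' cu i.η i.k i.Ω i.Λs)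
    (SB9 : ∀ i : ZdIdx θ.D θ.L, SockB9P3 (𝔸 := θ.𝔸) θ.L lam.inp.B₀ lam.B₀β cB9 lam.β lam.len i.η i.k i.Ω i.Λs i.Λb)
    (p5e : B8.Prop5Exists lam.inp.B₀' lam.B₁ lam.lan) (p5u : B8.Prop5Unique lam.lan) (p6 : B8.Prop6Printed θ.D (θ.L : ℝ) lam.B₁ lam.c₁ lam.cub)
    (p7 : B8SectGH.Prop7PrintedR (famB8OfRecord θ.toStage3Params lam.β lam.len) lam.toAxial)
    (t8 : B8Thm8Surviving.Thm8SurvivingAt 1 lam.B₁ lam.B₂ (famB8OfRecord θ.toStage3Params lam.β lam.len)) (P : B12.RunParams) :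
    Dag.B8_main (leavesP w P) :=
  b8_main_of_up_view₁₁B8B10YZW θ lam Mstar ops ζ lamW w hup
    (fun _ => b8LeafOfRecord_of_knit lam hD hB₁' hB hB₀β hC₂ hcu hcF₀ hcF hc59 hcu' hcB9 SHFP₀ SHFP SH59 SP5u SB9 p5e p5u p6 p7 t8) P

/-- **THE FOUR-SOCKET FACE OF `B8LeafOfRecord` — n05-a g6's `B8LeafKnitZd3B9All.b8LeafRS_zd3_univ_b9all` AT THE GROUP OF RECORD, BY NAME**: as g31's `b8LeafOfRecord_of_knit`
but with the in-edge b9 as ONE all-levels hypothesis per member `SB9all : ∀ i, ∀ m ≤ i.k, SockB9P3 … m …` (dag-n06-b's supply shape, fed by `B8LeafSocketsB9OfThm33.sB9all_of_thm33`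
from [4] Thm 3.3-as-sentence), the (1.59) socket `SockH59` SERVED from it — FOUR sockets (`SockHFP₀`, `SockHFP`, `SockP5u`, `SB9all`) + the five printed members.
NOT a discharge of N05. [cite: Balaban1985RegularSpaces, Lemma 1 p.79, Thm 2 p.83, Prop. 3 p.87, Thm 4 p.88 (kernel instances, n05-a); Prop. 5 p.94, Prop. 6 p.99, Prop. 7 p.100, Thm 8 p.101 (named hypotheses); Balaban1985BackgroundPropagators, Thm 3.3 p.398 (the in-edge)] -/
theorem b8LeafOfRecord_of_knit_b9all {θ : Stage3Params} (lam : ResidB8 θ) (hD : 2 ≤ θ.D) (hB₁' : lam.B₁' = 5 * (θ.D : ℝ) * θ.L * lam.inp.B₀)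
    {cu cF₀ cF cu' cB9 : ℝ} (hB : 2 ≤ 5 * (θ.D : ℝ) * θ.L * lam.inp.B₀) (hB₀β : 0 < lam.B₀β) (hC₂ : 2097152 * ((θ.D : ℝ) + 1) ^ 2 ≤ lam.C₂)
    (hcu : 0 < cu) (hcF₀ : 0 < cF₀) (hcF : 0 < cF) (hcu' : 0 < cu') (hcB9 : 0 < cB9)
    (SHFP₀ : ∀ i : ZdIdx θ.D θ.L, SockHFP₀ (𝔸 := θ.𝔸) θ.L lam.inp.B₀ lam.inp.B₀' cF₀ i.η i.k i.Ω i.Λs)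
    (SHFP : ∀ i : ZdIdx θ.D θ.L, SockHFP (𝔸 := θ.𝔸) θ.L lam.inp.B₀ lam.inp.B₀' cF i.η i.k i.Ω i.Λs)
    (SP5u : ∀ i : ZdIdx θ.D θ.L, SockP5u (𝔸 := θ.𝔸) θ.L cu' cu i.η i.k i.Ω i.Λs)
    (SB9all : ∀ i : ZdIdx θ.D θ.L, ∀ m, m ≤ i.k → SockB9P3 (𝔸 := θ.𝔸) θ.L lam.inp.B₀ lam.B₀β cB9 lam.β lam.len i.η m i.Ω i.Λs i.Λb)
    (p5e : B8.Prop5Exists lam.inp.B₀' lam.B₁ lam.lan) (p5u : B8.Prop5Unique lam.lan) (p6 : B8.Prop6Printed θ.D (θ.L : ℝ) lam.B₁ lam.c₁ lam.cub)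
    (p7 : B8SectGH.Prop7PrintedR (famB8OfRecord θ lam.β lam.len) lam.toAxial)
    (t8 : B8Thm8Surviving.Thm8SurvivingAt 1 lam.B₁ lam.B₂ (famB8OfRecord θ lam.β lam.len)) : B8LeafOfRecord θ lam := by
  rw [B8LeafOfRecord, hB₁']
  exact B8LeafKnitZd3B9All.b8LeafRS_zd3_univ_b9all hD θ.two_le_L θ.L lam.β lam.len lam.inp hB hB₀β hC₂ hcu hcF₀ hcF hcu' hcB9 SHFP₀ SHFP
    SP5u SB9all p5e p5u p6 p7 t8

/-- **THE KNIT AT ₁₁, FOUR-SOCKET TWIN** — `b8_main_of_up_view₁₁B8B10YZW_of_knit` with b9 as ONE all-levels socket `SB9all` per member (n05-a g6's knit; the socket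
providers in flight land against THIS face: `SockHFP₀ ∕ SockHFP` ⇐ the [4]-letters socket + windows via `B8SockHFPAssembly`, `SockP5u` ⇐ n04-b's converse of the JOIN,
`SB9all` ⇐ N06's `sB9all_of_thm33`). NOT a discharge of N05. [cite: Balaban1985RegularSpaces, Lemma 1 – Thm 8 pp.79–101; Balaban1985BackgroundPropagators, Thm 3.3 p.398] -/
theorem b8_main_of_up_view₁₁B8B10YZW_of_knit_b9all (θ : Stage11Params F N) (hD : 2 ≤ θ.D) (lam : ResidB8 θ.toStage3Params) (Mstar : ℕ)
    (ops : OpsY N θ.toStage3Params Mstar) (ζ : ResidZ F N) (lamW : ResidW F N) (w : WorldP)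
    (hup : ∀ P, w.up P = upOfRecord₅CS F N (θ.view₁₁B8B10YZW F N lam Mstar ops ζ lamW) P)
    (hB₁' : lam.B₁' = 5 * (θ.D : ℝ) * θ.L * lam.inp.B₀) {cu cF₀ cF cu' cB9 : ℝ} (hB : 2 ≤ 5 * (θ.D : ℝ) * θ.L * lam.inp.B₀) (hB₀β : 0 < lam.B₀β)
    (hC₂ : 2097152 * ((θ.D : ℝ) + 1) ^ 2 ≤ lam.C₂) (hcu : 0 < cu) (hcF₀ : 0 < cF₀) (hcF : 0 < cF) (hcu' : 0 < cu') (hcB9 : 0 < cB9)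
    (SHFP₀ : ∀ i : ZdIdx θ.D θ.L, SockHFP₀ (𝔸 := θ.𝔸) θ.L lam.inp.B₀ lam.inp.B₀' cF₀ i.η i.k i.Ω i.Λs)
    (SHFP : ∀ i : ZdIdx θ.D θ.L, SockHFP (𝔸 := θ.𝔸) θ.L lam.inp.B₀ lam.inp.B₀' cF i.η i.k i.Ω i.Λs)
    (SP5u : ∀ i : ZdIdx θ.D θ.L, SockP5u (𝔸 := θ.𝔸) θ.L cu' cu i.η i.k i.Ω i.Λs)
    (SB9all : ∀ i : ZdIdx θ.D θ.L, ∀ m, m ≤ i.k →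
      SockB9P3 (𝔸 := θ.𝔸) θ.L lam.inp.B₀ lam.B₀β cB9 lam.β lam.len i.η m i.Ω i.Λs i.Λb)
    (p5e : B8.Prop5Exists lam.inp.B₀' lam.B₁ lam.lan) (p5u : B8.Prop5Unique lam.lan) (p6 : B8.Prop6Printed θ.D (θ.L : ℝ) lam.B₁ lam.c₁ lam.cub)
    (p7 : B8SectGH.Prop7PrintedR (famB8OfRecord θ.toStage3Params lam.β lam.len) lam.toAxial)
    (t8 : B8Thm8Surviving.Thm8SurvivingAt 1 lam.B₁ lam.B₂ (famB8OfRecord θ.toStage3Params lam.β lam.len)) (P : B12.RunParams) :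
    Dag.B8_main (leavesP w P) :=
  b8_main_of_up_view₁₁B8B10YZW θ lam Mstar ops ζ lamW w hup
    (fun _ => b8LeafOfRecord_of_knit_b9all lam hD hB₁' hB hB₀β hC₂ hcu hcF₀ hcF hcu' hcB9 SHFP₀ SHFP SP5u SB9all p5e p5u p6 p7 t8) P

end Pointed

/-! ## §3 guards — why the ∀-form over ₁₁CB10YZWB8 is not an N05 target (it is REFUTED under inhabitation), and what N05 costs in K1's ∃-currency -/

section Guards

variable {F : T4Family}

/-- **A WORLD PRESENTED BY A GIVEN PACKAGE, at Stage 11, five pins exposed**: every admissible Stage-11 parameter with its provisos and a positive window, EVERY residual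
[B8] layer `λ`, floor, operator layer (and any [B11] ∕ [IV] layers) present a ₁₁CB10YZWB8 record `(datumOfRecord₁₁ θ h, w)` whose `b8` leaf IS `B8LeafOfRecord θ₃ λ` and
whose `b9` leaf IS `B9LeafX (Y9OfRecord N θ₃ M⋆ ops)` at every run (g31's `exists_world_isRecordOfRecord₁₁CB10YZWB8`, rebuilt with the binding exposed).
[cite: Balaban1985RegularSpaces, Lemma 1 – Thm 8 pp.79–101; Balaban1985BackgroundPropagators, Thm 3.1 p.397 (bookkeeping: the record's `b8` ∕ `b9` faces)] -/
theorem exists_record₁₁CB10YZWB8_leaves_iff (θ : Stage11Params F N) (h : θ.Provisos₁₁) (hθ : θ.Admissible) (hγ : 0 < θ.γ) (lam : ResidB8 θ.toStage3Params)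
    (Mstar : ℕ) (ops : OpsY N θ.toStage3Params Mstar) (ζ : ResidZ F N) (lamW : ResidW F N) :
    ∃ w : WorldP, IsRecordOfRecord₁₁CB10YZWB8 F N (datumOfRecord₁₁ F N θ h) w ∧
      (∀ P, w.up P = upOfRecord₅CS F N (θ.view₁₁B8B10YZW F N lam Mstar ops ζ lamW) P) ∧
      ∀ P : B12.RunParams, ((leavesP w P).b8 ↔ B8LeafOfRecord θ.toStage3Params lam) ∧
        ((leavesP w P).b9 ↔ B9LeafX (Y9OfRecord N θ.toStage3Params Mstar ops)) := by
  obtain ⟨w₀, -, -⟩ := exists_world_isRecordOfRecord₁₁C F N θ h hθ ⟨hγ, le_rfl⟩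
  refine ⟨{ w₀ with
      C := (datumOfRecord₁₁ F N θ h).C, γ := θ.γ, L := (θ.L : ℝ), one_lt_L := by exact_mod_cast θ.hL.2,
      up := fun P => upOfRecord₅CS F N (θ.view₁₁B8B10YZW F N lam Mstar ops ζ lamW) P },
    ⟨θ, h, lam, Mstar, ops, ζ, lamW, hθ, rfl, rfl, ⟨hγ, le_rfl⟩, rfl, fun _ => rfl⟩, fun _ => rfl, fun P => ?_⟩
  exact ⟨(upOfRecord₅CS_view₁₁B8B10YZW_leaves F N θ lam Mstar ops ζ lamW P).1,
    (upOfRecord₅CS_view₁₁B8B10YZW_leaves F N θ lam Mstar ops ζ lamW P).2.2.1⟩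

/-- **THE STAGE-11-PRESENTED DICTIONARIES, BY NAME**: `S_N05 (₁₁CB10YZWB8)` ⟺ «for every family, every admissible `θ : Stage11Params` satisfying its provisos with
`0 < θ.γ`, EVERY residual [B8] layer `λ`, floor and operator layer: `B9LeafX (Y9OfRecord N θ₃ M⋆ ops) → B8LeafOfRecord θ₃ λ`» — the face that is NEW at the five-pin record
(the ∀-form read through g31's pins; the [B11] ∕ [IV] layers drop out, `nonempty_residZ ∕ nonempty_residW` supply them).
[cite: Balaban1985RegularSpaces, Lemma 1 – Thm 8 pp.79–101 (bookkeeping)] -/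
theorem s_N05_iff₁₁CB10YZWB8_bundles :
    S_N05 (fun F D w => IsRecordOfRecord₁₁CB10YZWB8 F N D w) ↔
      ∀ (F : T4Family) (θ : Stage11Params F N) (_ : θ.Provisos₁₁), θ.Admissible → 0 < θ.γ →
        ∀ (lam : ResidB8 θ.toStage3Params) (Mstar : ℕ) (ops : OpsY N θ.toStage3Params Mstar),
          B9LeafX (Y9OfRecord N θ.toStage3Params Mstar ops) → B8LeafOfRecord θ.toStage3Params lam := by
  refine ⟨fun hS F θ h hθ hγ lam Mstar ops h9 => ?_, fun H F D w h P => ?_⟩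
  · obtain ⟨ζ⟩ := nonempty_residZ F N
    obtain ⟨lamW⟩ := nonempty_residW F N
    obtain ⟨w, hw, -, hiff⟩ := exists_record₁₁CB10YZWB8_leaves_iff θ h hθ hγ lam Mstar ops ζ lamW
    let P₀ : B12.RunParams := ⟨0, 0, 0⟩
    exact (hiff P₀).1.1 ((b8_main_iff_edge_of_isRecordOfRecord₁₁CB10YZWB8 hw P₀).1 (hS F _ w hw P₀) ((hiff P₀).2.2 h9))
  · obtain ⟨θ, hP, lam, Mstar, ops, ζ, lamW, hθ, -, -, hγ, -, hup⟩ := h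
    exact b8_main_of_up_view₁₁B8B10YZW θ lam Mstar ops ζ lamW w hup (H F θ hP hθ (hγ.1.trans_le hγ.2) lam Mstar ops) P

/-- **THE ∀-FORM OVER THE FIVE-PIN RECORD IS REFUTED BY ONE ADMISSIBLE STAGE-11 PARAMETER** (with provisos and `γ > 0` — i.e. under K0's inhabitation at this family):
def-Y's ZERO operator layer makes the extended [B9] leaf TRUE (`exists_junkOps_b9LeafX_Y9OfRecord`), g31's DEGENERATE residual [B8] layer (a Prop-5 family with no
Landau-gauge solutions) makes the surviving [B8] leaf FALSE (`exists_residB8_not_b8LeafOfRecord`), and the package presents a record — so `S_N05 (₁₁CB10YZWB8)` FAILS.  This is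
WHY the ∀-form over ₁₁CB10YZWB8 is not an N05 target and why the record predicate must pin `λ` (or K1 read N05 in ∃-currency) before any booking; nothing of print is refuted.
[cite: Balaban1985RegularSpaces, Prop. 5 p.94 (bookkeeping: the typed existence clause reads the residual carriers); Balaban1985BackgroundPropagators, Thms 3.1–3.15 pp.397–432 (junk satisfiability of the typed leaf)] -/
theorem not_s_N05_record₁₁CB10YZWB8 (θ : Stage11Params F N) (h : θ.Provisos₁₁) (hθ : θ.Admissible) (hγ : 0 < θ.γ) :
    ¬ S_N05 (fun F D w => IsRecordOfRecord₁₁CB10YZWB8 F N D w) := by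
  intro hS
  obtain ⟨lam, hlam⟩ := exists_residB8_not_b8LeafOfRecord θ.toStage3Params
  obtain ⟨ops, -, hleaf⟩ := exists_junkOps_b9LeafX_Y9OfRecord (N := N) θ.toStage3Params hθ.1.1.1.1.1 0
  exact hlam (s_N05_iff₁₁CB10YZWB8_bundles.1 hS F θ h hθ hγ lam 0 ops hleaf)

/-- **N05's ∀-form over the five-pin record and K0-style inhabitation are INCOMPATIBLE** (pointed corollary: if some family carries an admissible Stage-11 parameter with
provisos and `γ > 0`, the stub `S_N05 (₁₁CB10YZWB8)` is false). [cite: Balaban1985RegularSpaces, Prop. 5 p.94 (bookkeeping)] -/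
theorem not_s_N05_record₁₁CB10YZWB8_of_exists
    (hex : ∃ (F : T4Family) (θ : Stage11Params F N), θ.Provisos₁₁ ∧ θ.Admissible ∧ 0 < θ.γ) :
    ¬ S_N05 (fun F D w => IsRecordOfRecord₁₁CB10YZWB8 F N D w) := by
  obtain ⟨F, θ, h, hθ, hγ⟩ := hex
  exact not_s_N05_record₁₁CB10YZWB8 θ h hθ hγ

variable (F) in
/-- **INHABITED-AT-₁₁CB10YZWB8 ⟺ INHABITED-AT-₁₁C, family by family** (the five carrier pins add no proviso and no admissibility clause): the same-datum companion +
`isRecordOfRecord₁₁C_of_isRecordOfRecord₁₁CB10YZW` one way; the other way a ₁₁C record RE-BINDS (`isRecordOfRecord₁₁CB10YZWB8_rebind_of_isRecordOfRecord₁₁C`) for ANY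
residual [B8] layer (`nonempty_residB8`), floor `0`, def-Y's junk operator layer and any [B11] ∕ [IV] layers.  At `N = 2` the right-hand side is K0 `Record11Inhabited`'s body on
the family — neither proved nor assumed in this file. [cite: Balaban1989LargeFieldII, Thm 1 + (0.1) pp.355–356 (objects of record; bookkeeping)] -/
theorem inhabited₁₁CB10YZWB8_iff_inhabited₁₁C :
    (∃ (D : Datum F N) (w : WorldP), IsRecordOfRecord₁₁CB10YZWB8 F N D w) ↔
      ∃ (D : Datum F N) (w : WorldP), IsRecordOfRecord₁₁C F N D w := by
  refine ⟨fun ⟨D, w, h⟩ => ?_, fun ⟨D, w, h⟩ => ?_⟩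
  · obtain ⟨w', hw', -⟩ := companion_of_isRecordOfRecord₁₁CB10YZWB8 h
    exact ⟨D, w', isRecordOfRecord₁₁C_of_isRecordOfRecord₁₁CB10YZW hw'⟩
  · obtain ⟨θ, _, hθ, -, h11⟩ := isRecordOfRecord₁₁CB10YZWB8_rebind_of_isRecordOfRecord₁₁C h
    obtain ⟨lam⟩ := nonempty_residB8 (θ := θ.toStage3Params)
    obtain ⟨ops, -, -⟩ := exists_junkOps_b9LeafX_Y9OfRecord (N := N) θ.toStage3Params hθ.1.1.1.1.1 0
    obtain ⟨ζ⟩ := nonempty_residZ F N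
    obtain ⟨lamW⟩ := nonempty_residW F N
    exact ⟨D, _, h11 lam 0 ops ζ lamW⟩

/-- **WHAT N05 COSTS IN K1's ∃-CURRENCY (LOCATED)**: every Stage-11 record `(D, w)` of `IsRecordOfRecord₁₁C` is RE-PRESENTED — SAME datum `D`, same construction, window
and block size — for EVERY residual [B8] layer `λ` OF THE PROVER'S CHOICE by a five-pin world `w′` (the record's own parameters, floor `0`, def-Y's zero operator layer) at which
`Dag.B8_main (leavesP w′ P) ⟺ B8LeafOfRecord θ₃ λ` at EVERY run.  So in the V1 ∃-form of K1 `StabilityBAtRecordR11e` the N05 conjunct of `DagBinding.Nodes` at the chosen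
record IS the surviving [B8] leaf at the group of record for a NAMED `λ` — i.e. EXACTLY the hypothesis list of `b8_main_of_up_view₁₁B8B10YZW_of_knit(_b9all)` at
`(θ.𝔸, θ.D, θ.L, λ)`: the member-wise sockets + the five printed members.  NOT-A-DISCHARGE; nothing weaker than that list is claimed.
[cite: Balaban1985RegularSpaces, Lemma 1 – Thm 8 pp.79–101 (bookkeeping: the node at the re-presented Stage-11 record)] -/
theorem exists_rebind₁₁CB10YZWB8_of_isRecordOfRecord₁₁C {D : FiniteEpsData F (Node00.SU N)} {w : WorldP} (h : IsRecordOfRecord₁₁C F N D w) :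
    ∃ θ : Stage11Params F N, θ.Admissible ∧ w.L = (θ.L : ℝ) ∧ ∀ lam : ResidB8 θ.toStage3Params,
      ∃ w' : WorldP, IsRecordOfRecord₁₁CB10YZWB8 F N D w' ∧ w'.C = w.C ∧ w'.γ = w.γ ∧ w'.L = w.L ∧
        ∀ P : B12.RunParams, Dag.B8_main (leavesP w' P) ↔ B8LeafOfRecord θ.toStage3Params lam := by
  obtain ⟨θ, hP, hθ, hD, hC, hγ, hL, hup⟩ := h
  refine ⟨θ, hθ, hL, fun lam => ?_⟩
  obtain ⟨ops, -, hleaf⟩ := exists_junkOps_b9LeafX_Y9OfRecord (N := N) θ.toStage3Params hθ.1.1.1.1.1 0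
  obtain ⟨ζ⟩ := nonempty_residZ F N
  obtain ⟨lamW⟩ := nonempty_residW F N
  have hrec : IsRecordOfRecord₁₁CB10YZWB8 F N D
      { w with up := fun P => upOfRecord₅CS F N (θ.view₁₁B8B10YZW F N lam 0 ops ζ lamW) P } :=
    ⟨θ, hP, lam, 0, ops, ζ, lamW, hθ, hD, hC, hγ, hL, fun _ => rfl⟩
  refine ⟨_, hrec, rfl, rfl, rfl, fun P => ?_⟩
  refine ⟨fun h8 => ?_, fun hl => b8_main_of_up_view₁₁B8B10YZW θ lam 0 ops ζ lamW _ (fun _ => rfl) (fun _ => hl) P⟩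
  obtain ⟨-, h5, h6, h7⟩ := b4_b5_b6_b7_of_isRecordOfRecord₁₁CB10YZWB8 hrec P
  exact (upOfRecord₅CS_view₁₁B8B10YZW_leaves F N θ lam 0 ops ζ lamW P).1.1
    (h8 h5 h6 h7 ((upOfRecord₅CS_view₁₁B8B10YZW_leaves F N θ lam 0 ops ζ lamW P).2.2.1.2 hleaf))

end Guards

end Summit.QuantumFields.YangMills.BalabanUVNodes.N05AtRecord11CB10YZWB8

end
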